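import Summits.RiemannHypothesis.RiemannHypothesis.Theorems.Splittings.ScrewKreinDiscreteInertia
import Summits.RiemannHypothesis.RiemannHypothesis.Theorems.Splittings.ScrewIndexTransferKreinCore

/-!
# Screw index transfer, discrete Kreĭn core (2/3, v2): exponential sums and the bounded orbit function

rh-split-screw-bridge g6, lane (xii-d), file 2 of 3, v2 (cut of `xiid/ScrewKreinDiscreteCoreV2.lean`, §4–§5; the v1 `Staged`
copies of the (xii-c) Laplace lemmas are GONE — file 3 imports them from the landed (xii-c) modules through this file's
import of `…Splittings.ScrewIndexTransferKreinCore`).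

* §4 `expSum x w = Σ_t x(t) e^{wt}`; `exists_finset_expSum_eq_zero`: for `x` supported on `ηℤ ∩ [−dη, dη]` with
  `x(dη) ≠ 0`, the zeros `w` of `expSum x` have `e^{ηw}` in a finite set (`e^{dηw} A(w) = Pol(e^{ηw})`, `Pol ≠ 0`).
* §5 `orbitFun ψ a = BF fC ψ (U a ψ)`; `norm_orbitFun_le`: if `R` commutes with translations and `BF fC (Rv, Rv) ≥ 0` for
  all `v`, then `‖orbitFun (R δ₀) a‖ ≤ Re BF fC (R δ₀, R δ₀)` (positivity on the pencil `U_a δ₀ − l δ₀`).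

Classification tags: [folklore] = standard analysis/algebra; [new-combination] = assembled here.
HONEST LABEL: SPLITTING SEARCH over kernel-typed RH-EQUIVALENCES; `etail_iff_foz` relates two OPEN tail statements and
decides neither; nothing here bears on the truth of RH.
-/

noncomputable section

set_option linter.dupNamespace false

namespace Summit.RiemannHypothesis.RiemannHypothesis.Theorems.Splittings.ScrewKreinDiscrete

open Finset Complex MeasureTheory Set Filter Topology Polynomial Module
open scoped ComplexConjugate Matrix
open Literature.NumberTheory.LFunctions
open Literature.Analysis.OperatorTheory
open Literature.Analysis.OperatorTheory.KreinStewart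
open Summit.RiemannHypothesis.RiemannHypothesis.Theses.RuelleBand
open Summit.RiemannHypothesis.RiemannHypothesis.Theorems.IntegerScrew
open Summit.RiemannHypothesis.RiemannHypothesis.Theorems.Splittings.ScrewKreinCore
open Summit.RiemannHypothesis.RiemannHypothesis.Theorems.Splittings.ScrewIndexTransferKrein

/-! ## §4 Exponential sums over a lattice-supported vector: zeros confine `e^{ηw}` to a finite set -/

/-- The exponential sum `A_x(w) = Σ_{t ∈ supp x} x(t) e^{wt}` of a finitely supported `x`. -/
def expSum (x : ℝ →₀ ℂ) (w : ℂ) : ℂ := ∑ t ∈ x.support, x t * cexp (w * t)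

/-- `A_x` is entire. [folklore] -/
theorem differentiable_expSum (x : ℝ →₀ ℂ) : Differentiable ℂ (expSum x) := by
  unfold expSum
  fun_prop

/-- **Lattice lemma.** If `x` is supported on `{mη : −d ≤ m ≤ d}` with `x(dη) ≠ 0` (`η ≠ 0`), then
`e^{dηw} A_x(w) = Pol(e^{ηw})` for a NON-ZERO polynomial `Pol`; hence the zeros `w` of `A_x` have `e^{ηw}` in the
finite root set of `Pol`. [folklore] -/
theorem exists_finset_expSum_eq_zero (η : ℝ) (hη : η ≠ 0) (d : ℕ) (x : ℝ →₀ ℂ)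
    (hsupp : ∀ t ∈ x.support, ∃ m : ℤ, t = m * η ∧ -(d : ℤ) ≤ m ∧ m ≤ d)
    (htop : x ((d : ℝ) * η) ≠ 0) :
    ∃ Z : Finset ℂ, ∀ w : ℂ, expSum x w = 0 → cexp (η * w) ∈ Z := by
  classical
  -- the polynomial
  set I : Finset ℤ := Finset.Icc (-(d : ℤ)) d with hI
  set Pol : ℂ[X] := ∑ m ∈ I, Polynomial.C (x ((m : ℝ) * η)) * X ^ (m + d).toNat with hPol
  have hcoeff : Pol.coeff (2 * d) = x ((d : ℝ) * η) := by
    rw [hPol, Polynomial.finsetSum_coeff, Finset.sum_eq_single_of_mem (d : ℤ) (by rw [hI, Finset.mem_Icc]; omega)]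
    · rw [Polynomial.coeff_C_mul, Polynomial.coeff_X_pow, if_pos (by omega), mul_one]
      norm_cast
    · intro m hm hmd
      rw [hI, Finset.mem_Icc] at hm
      rw [Polynomial.coeff_C_mul, Polynomial.coeff_X_pow, if_neg (by omega), mul_zero]
  have hPol0 : Pol ≠ 0 := fun h => htop (by rw [← hcoeff, h, Polynomial.coeff_zero])
  -- the identity `e^{dηw} A_x(w) = Pol(e^{ηw})`
  have hsum : ∀ w : ℂ, expSum x w = ∑ m ∈ I, x ((m : ℝ) * η) * cexp (w * (((m : ℝ) * η : ℝ) : ℂ)) := by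
    intro w
    have hinj : ∀ m ∈ I, ∀ m' ∈ I, (fun m : ℤ => (m : ℝ) * η) m = (fun m : ℤ => (m : ℝ) * η) m' → m = m' := by
      intro m _ m' _ h
      have := mul_right_cancel₀ hη h
      exact_mod_cast this
    rw [expSum, ← Finset.sum_image (f := fun t : ℝ => x t * cexp (w * t)) hinj]
    refine Finset.sum_subset (fun t ht => ?_) (fun t _ ht => ?_)
    · obtain ⟨m, hm, hlo, hhi⟩ := hsupp t ht
      exact Finset.mem_image.mpr ⟨m, by rw [hI, Finset.mem_Icc]; omega, hm.symm⟩
    · rw [Finsupp.notMem_support_iff.mp ht, zero_mul]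
  have hid : ∀ w : ℂ, cexp ((d : ℂ) * (η * w)) * expSum x w = Pol.eval (cexp (η * w)) := by
    intro w
    rw [hsum, hPol, Polynomial.eval_finsetSum, Finset.mul_sum]
    refine Finset.sum_congr rfl fun m hm => ?_
    rw [hI, Finset.mem_Icc] at hm
    rw [Polynomial.eval_mul, Polynomial.eval_C, Polynomial.eval_pow, Polynomial.eval_X, ← Complex.exp_nat_mul,
      mul_left_comm, ← Complex.exp_add]
    congr 2
    have : (((m + d).toNat : ℕ) : ℂ) = (m : ℂ) + d := by
      have h0 : 0 ≤ m + d := by omega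
      have : (((m + d).toNat : ℤ) : ℂ) = ((m + d : ℤ) : ℂ) := by rw [Int.toNat_of_nonneg h0]
      push_cast at this ⊢
      exact this
    rw [this]
    push_cast
    ring
  refine ⟨Pol.roots.toFinset, fun w hw => ?_⟩
  rw [Multiset.mem_toFinset, Polynomial.mem_roots hPol0, Polynomial.IsRoot.def, ← hid, hw, mul_zero]

/-! ## §5 Positivity on a translation orbit: the bounded continuous function `g(a) = BF ψ (U a ψ)` -/

/-- The orbit function `g_ψ(a) = BF_f(ψ, U_a ψ) = Σ_s Σ_t conj(ψ s) ψ t f(t + a − s)`. -/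
def orbitFun (ψ : ℝ →₀ ℂ) (a : ℝ) : ℂ := BF fC ψ (U a ψ)

/-- Explicit double-sum formula for the orbit function. [folklore] -/
theorem orbitFun_eq (ψ : ℝ →₀ ℂ) (a : ℝ) :
    orbitFun ψ a = ∑ s ∈ ψ.support, ∑ t ∈ ψ.support, conj (ψ s) * ψ t * fC (t + a - s) := by
  classical
  have hsub : (U a ψ).support ⊆ Finset.image (fun s : ℝ => s + a) ψ.support := by
    rw [U, Finsupp.lmapDomain_apply]
    exact Finsupp.mapDomain_support
  rw [orbitFun, BF_apply, kf_eq fC subset_rfl hsub]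
  refine Finset.sum_congr rfl fun s _ => ?_
  rw [Finset.sum_image fun t _ t' _ h => add_right_cancel h]
  refine Finset.sum_congr rfl fun t _ => ?_
  rw [U_apply_pt, add_sub_cancel_right]

/-- The orbit function is continuous. [folklore] -/
theorem continuous_orbitFun (ψ : ℝ →₀ ℂ) : Continuous (orbitFun ψ) := by
  have : orbitFun ψ = fun a => ∑ s ∈ ψ.support, ∑ t ∈ ψ.support, conj (ψ s) * ψ t * fC (t + a - s) :=
    funext (orbitFun_eq ψ)
  rw [this]
  refine continuous_finsetSum _ fun s _ => continuous_finsetSum _ fun t _ => ?_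
  exact continuous_const.mul
    (continuous_ofReal.comp (continuous_zetaScrew.comp ((continuous_const.add continuous_id).sub
      continuous_const)).neg)

/-- **Positivity ⟹ boundedness** (the pencil trick): if `Re BF(R v, R v) ≥ 0` for all `v`, with `R` commuting
with translations and `ψ = R δ₀`, then `|g_ψ(a)| ≤ g_ψ(0) = Re BF(ψ, ψ)`. [folklore] -/
theorem norm_orbitFun_le (R : Module.End ℂ (ℝ →₀ ℂ)) (hR : ∀ a : ℝ, Commute (U a : Module.End ℂ (ℝ →₀ ℂ)) R)
    (hpos : ∀ v : ℝ →₀ ℂ, 0 ≤ (BF fC (R v) (R v)).re) (a : ℝ) :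
    ‖orbitFun (R (Finsupp.single 0 1)) a‖ ≤ (BF fC (R (Finsupp.single 0 1)) (R (Finsupp.single 0 1))).re := by
  set ψ := R (Finsupp.single 0 1) with hψ
  set G : ℂ := BF fC ψ ψ with hG
  set ga : ℂ := BF fC ψ (U a ψ) with hga
  have hsymm := isSymm_BF fC_symm
  have hGreal : conj G = G := hsymm.eq ψ ψ
  have hG0 : 0 ≤ G.re := hpos (Finsupp.single 0 1)
  have hUU : BF fC (U a ψ) (U a ψ) = G := by rw [BF_U, U_U, neg_add_cancel, U_zero]
  have hcross : BF fC (U a ψ) ψ = conj ga := (hsymm.eq ψ (U a ψ)).symm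
  -- positivity on `U a ψ − l • ψ = R (U a δ₀ − l • δ₀)`
  have key : ∀ l : ℂ, 0 ≤ (G - l * conj ga - conj l * ga + conj l * l * G).re := by
    intro l
    have hv : R (U a (Finsupp.single 0 1) - l • Finsupp.single 0 1) = U a ψ - l • ψ := by
      rw [map_sub, map_smul, hψ]
      congr 1
      have hc := LinearMap.congr_fun (hR a).eq (Finsupp.single 0 1)
      rw [Module.End.mul_apply, Module.End.mul_apply] at hc
      exact hc.symm
    have h := hpos (U a (Finsupp.single 0 1) - l • Finsupp.single 0 1)
    rw [hv, LinearMap.map_sub₂, LinearMap.map_smulₛₗ₂, map_sub, map_sub, map_smul, map_smul, hUU, hcross,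
      ← hga, ← hG] at h
    simp only [smul_eq_mul, starRingEnd_apply] at h
    convert h using 2
    simp only [Complex.star_def]
    ring
  show ‖ga‖ ≤ G.re
  by_cases hga0 : ga = 0
  · rw [hga0, norm_zero]; exact hG0
  · have hn : (‖ga‖ : ℂ) ≠ 0 := by exact_mod_cast (norm_ne_zero_iff.mpr hga0)
    have h := key (ga / (‖ga‖ : ℂ))
    have e1 : ga / (‖ga‖ : ℂ) * conj ga = (‖ga‖ : ℂ) := by
      rw [div_mul_eq_mul_div, Complex.mul_conj', sq, mul_div_assoc, div_self hn, mul_one]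
    have e2 : conj (ga / (‖ga‖ : ℂ)) * ga = (‖ga‖ : ℂ) := by
      rw [map_div₀, Complex.conj_ofReal, div_mul_eq_mul_div, Complex.conj_mul', sq, mul_div_assoc,
        div_self hn, mul_one]
    have e3 : conj (ga / (‖ga‖ : ℂ)) * (ga / (‖ga‖ : ℂ)) = 1 := by
      rw [map_div₀, Complex.conj_ofReal, div_mul_div_comm, Complex.conj_mul', sq, div_self (mul_ne_zero hn hn)]
    rw [e1, e2, e3, one_mul] at h
    have : (G - (‖ga‖ : ℂ) - (‖ga‖ : ℂ) + G).re = 2 * G.re - 2 * ‖ga‖ := by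
      simp only [Complex.sub_re, Complex.add_re, Complex.ofReal_re]; ring
    rw [this] at h
    linarith

end Summit.RiemannHypothesis.RiemannHypothesis.Theorems.Splittings.ScrewKreinDiscrete
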